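import Mathlib
import Literature.NumberTheory.LFunctions.Zhang2022.SkeletonPartThree
import Literature.NumberTheory.Sieve.BombieriAsymptoticSieveShiftedPrimes
import HarnessLib

/-!
# Zhang (2022) §15, the last step: (15.6) + (15.17) + (15.23) + the values `ℛ₁*ℛ₁ⱼ` ⇒ (15.24)

Topic `Literature/NumberTheory/LFunctions/Zhang2022` (Landau–Siegel audit tree; verdict-neutral).
Y. Zhang, *Discrete mean estimates and the Landau–Siegel zero*, arXiv:2211.02515v1 (2022)
[Zhang2022LandauSiegel] — an unrefereed manuscript under adjudication (cell siegel-zhang, D-0069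
width campaign, discharge lane, node `Skeleton.Ded1524` = cone leaf C38). §15 p. 88 (tex L4394–4396)
concludes "(15.24) `Φ₁ = (𝔢₁ + 2𝔢₂ + 𝔢₃)𝔞𝔓 + o(𝔓)`" by "Combining these relations [`ℛ₁*ℛ₁₁ = 1 +
O(1/𝓛)`, `ℛ₁*ℛ₁₂ = 2 + O(1/𝓛)`, `ℛ₁*ℛ₁₃ = 1 + O(1/𝓛)`, §15.u060–u062] with (15.23) [`𝒮₁ⱼ =
𝔢ⱼ𝔞φ(D)/D + O(1/𝓛³)`], (15.17) [`Φ₁(p) = ℛ₁*Dpφ(D)⁻¹Σ_{j≤3}ℛ₁ⱼ𝒮₁ⱼ + o(p)`] and (15.6) [`Φ₁ =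
Σ_{p∼P}Φ₁(p) + o(𝔓)`]". This file KERNEL-CHECKS that deduction, ABSTRACTLY in the §15A/B objects
`Φ₁(p)`, `𝒮₁ⱼ`, `ℛ₁ⱼ`, `ℛ₁*` (functions of `(D, χ, ·)`; the typed slices `TypedSection15A/B/C`
instantiate them), against the banked target `Skeleton.Eval1524 c′` (absolute `o(𝔓)`):

* `eval1524_of_coeff` — (15.6) + (15.17) + "the coefficient of `p`, `(D/φ(D))Σⱼℛ₁*ℛ₁ⱼ𝒮₁ⱼ`, tends
  to `(𝔢₁+2𝔢₂+𝔢₃)𝔞`" ⇒ (15.24) (the main term of (15.17) is linear in `p`, and `Σ_{p∼P} p = 𝔓`);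
* `coeff_eventually` — the coefficient limit from the two EXACT requirements
  `(D/φ(D))·|𝒮₁ⱼ − 𝔢ⱼ𝔞φ(D)/D| → 0` and `δ(1 + 𝔞) → 0`, `δ = Σⱼ|ℛ₁*ℛ₁ⱼ − (1,2,1)ⱼ|`;
* `eta_small_of_rate` — (15.23)'s printed `O(𝓛⁻³)` gives the first (`D/φ(D) ≤ (1 + log D)²`, the
  tree's `Sieve.natCast_div_totient_le`);
* `delta_small_of_rate5` — a rate `ℛ₁*ℛ₁ⱼ = (1,2,1)ⱼ + O(𝓛⁻⁵)` gives the second with only the crude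
  `𝔞 ≤ 16e⁹𝓛⁴` ((2.31) + the tree's `Lemma31.norm_deriv_LFunction_le_near_one`);
* `eval1524_of_rates` — hence (15.24) from (15.6), (15.17), (15.23) and the FINER rate `O(𝓛⁻⁵)`.

FINDING recorded by this typing (a gap candidate for the cell's ledger, not a verdict): with the
PRINTED rate `O(1/𝓛)` of u060–u062 the error of the main term is `O(𝔞𝔓/𝓛)`, which is `o(𝔓)` only
if `𝔞 = o(𝓛)`; the manuscript states "(A) implies `𝔞 ≫ 1`" (§2 p.6) and no upper bound (the tree has
`frakALowerBound_holds` and the crude `𝔞 ≪ 𝓛⁴`). The companion file `Section15Ded1524` records the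
printed route with the extra hypothesis `𝔞 ≤ A₀` and derives the finer rate from u058–u059
(Lemma 5.8's values of `ℛ₁*`, `ℛ₁ⱼ`), which closes the step without it.

WHAT THIS IS NOT: a proof of (15.6), (15.17) or (15.23) (CLAIM nodes of the manuscript, typed in
`TypedSection15A/B/C`), nor any claim about Theorems 1–2 or Landau–Siegel zeros.

## References
* Y. Zhang, arXiv:2211.02515v1 (2022), §15 pp. 82–88, (15.6), (15.17), (15.23), (15.24); §2 (2.31).
  [cite: Zhang2022LandauSiegel, §15 (15.24) p.88]
-/

noncomputable section

open Complex Real ComplexConjugate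
open Literature.NumberTheory.LFunctions.Zhang2022.Skeleton

namespace Literature.NumberTheory.LFunctions.Zhang2022.Ded1524

/-! ## 1. Pointwise algebra of the last step -/

/-- The identity behind "Combining these relations with (15.23), (15.17)": with `t = D/φ(D)`,
`t·(u·S) − m·e·A = (u − m)·e·A + t·u·(S − e·A·φ(D)/D)`. [cite: Zhang2022LandauSiegel, §15 (15.24) p.88] -/
private theorem comb_identity (t u S m e A : ℂ) (ht : t ≠ 0) :
    t * (u * S) - m * e * A = (u - m) * e * A + t * u * (S - e * A * t⁻¹) := by
  field_simp
  ring

/-- Norm form of `comb_identity`: `‖t(uS) − meA‖ ≤ ‖u − m‖‖e‖A + t(‖m‖ + ‖u − m‖)‖S − eA/t‖` for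
real `t > 0`, `A ≥ 0`. [cite: Zhang2022LandauSiegel, §15 (15.24) p.88] -/
private theorem norm_comb_le {t A : ℝ} (ht : 0 < t) (hA : 0 ≤ A) (u S m e : ℂ) :
    ‖(t : ℂ) * (u * S) - m * e * A‖ ≤
      ‖u - m‖ * ‖e‖ * A + t * (‖m‖ + ‖u - m‖) * ‖S - e * A * (t : ℂ)⁻¹‖ := by
  rw [comb_identity (t : ℂ) u S m e A (by exact_mod_cast ht.ne')]
  refine (norm_add_le _ _).trans ?_
  have h1 : ‖(u - m) * e * (A : ℂ)‖ = ‖u - m‖ * ‖e‖ * A := by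
    rw [norm_mul, norm_mul, Complex.norm_of_nonneg hA]
  have h2 : ‖(t : ℂ) * u * (S - e * A * (t : ℂ)⁻¹)‖ ≤
      t * (‖m‖ + ‖u - m‖) * ‖S - e * A * (t : ℂ)⁻¹‖ := by
    rw [norm_mul, norm_mul, Complex.norm_of_nonneg ht.le]
    gcongr
    calc ‖u‖ = ‖m + (u - m)‖ := by ring_nf
      _ ≤ ‖m‖ + ‖u - m‖ := norm_add_le _ _
  rw [h1]
  linarith

/-- `log D ≥ M` once `D ≥ ⌈e^M⌉`. [folklore] -/
private theorem le_ell_of_ceil_exp_le {M : ℝ} {D : ℕ} (hD : ⌈Real.exp M⌉₊ ≤ D) : M ≤ ell D := by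
  have h : Real.exp M ≤ D := le_trans (Nat.le_ceil _) (by exact_mod_cast hD)
  exact (Real.le_log_iff_exp_le (lt_of_lt_of_le (Real.exp_pos _) h)).mpr h

/-- `𝔞𝓛⁻⁵ ≤ 16e⁹𝓛⁻¹` for `χ` primitive, `log D ≥ 3` — from `𝔞 = (6/π²)L′(1,χ)²∏_{q∣D} q/(q+1)` (2.31)
and the tree's Cauchy bound `|L′(1,χ)| ≤ 2e^{9/2}(1+𝓛)𝓛 ≤ 4e^{9/2}𝓛²`
(`Lemma31.norm_deriv_LFunction_le_near_one`), i.e. `𝔞 ≤ 16e⁹𝓛⁴`. [cite: Zhang2022LandauSiegel, §2 (2.31)] -/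
private theorem frakA_div_le {D : ℕ} [NeZero D] (χ : DirichletCharacter ℂ D) (hℓ : 3 ≤ Real.log D)
    (hχ : χ.IsPrimitive) : frakA χ / ell D ^ 5 ≤ 16 * Real.exp 9 / ell D := by
  have hL := Lemma31.norm_deriv_LFunction_le_near_one χ hℓ hχ (w := 1) (by simp; positivity)
  set L : ℝ := Real.log D with hLdef
  have hell : ell D = L := rfl
  have hL1 : 1 ≤ L := by linarith
  have hL0 : 0 < L := by linarith
  have hE : Real.exp (9 / 2) * Real.exp (9 / 2) = Real.exp 9 := by rw [← Real.exp_add]; norm_num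
  have hnorm : ‖deriv χ.LFunction 1‖ ≤ 4 * Real.exp (9 / 2) * L ^ 2 := by
    calc ‖deriv χ.LFunction 1‖ ≤ 2 * Real.exp (9 / 2) * (1 + L) * L := hL
      _ ≤ 2 * Real.exp (9 / 2) * (L + L) * L := by gcongr
      _ = 4 * Real.exp (9 / 2) * L ^ 2 := by ring
  have hre : (deriv χ.LFunction 1).re ^ 2 ≤ (4 * Real.exp (9 / 2) * L ^ 2) ^ 2 := by
    have h1 : |(deriv χ.LFunction 1).re| ≤ 4 * Real.exp (9 / 2) * L ^ 2 :=
      (Complex.abs_re_le_norm _).trans hnorm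
    calc (deriv χ.LFunction 1).re ^ 2 = |(deriv χ.LFunction 1).re| ^ 2 := (sq_abs _).symm
      _ ≤ (4 * Real.exp (9 / 2) * L ^ 2) ^ 2 := by gcongr
  have hprod : ∏ p ∈ D.primeFactors, ((p : ℝ) / (p + 1)) ≤ 1 :=
    Finset.prod_le_one (fun p _ => by positivity) fun p _ => by
      rw [div_le_one (by positivity)]; linarith
  have hπ : 6 / π ^ 2 ≤ 1 := by
    rw [div_le_one (by positivity)]; nlinarith [Real.pi_gt_three]
  have hA : frakA χ ≤ 16 * Real.exp 9 * L ^ 4 := by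
    rw [frakA, Lemma171.frakA]
    calc 6 / π ^ 2 * (deriv χ.LFunction 1).re ^ 2 * ∏ p ∈ D.primeFactors, ((p : ℝ) / (p + 1))
        ≤ 1 * (4 * Real.exp (9 / 2) * L ^ 2) ^ 2 * 1 := by gcongr
      _ = 16 * (Real.exp (9 / 2) * Real.exp (9 / 2)) * L ^ 4 := by ring
      _ = 16 * Real.exp 9 * L ^ 4 := by rw [hE]
  rw [hell, div_le_div_iff₀ (pow_pos hL0 5) hL0]
  calc frakA χ * L ≤ 16 * Real.exp 9 * L ^ 4 * L := by gcongr
    _ = 16 * Real.exp 9 * L ^ 5 := by ring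

/-- `D/φ(D) ≤ 4𝓛²` for `log D ≥ 1` (from the tree's `d/φ(d) ≤ (1 + log d)²`). [folklore] -/
private theorem totientRatio_le {D : ℕ} (hℓ : 1 ≤ ell D) :
    (D : ℝ) / Nat.totient D ≤ 4 * ell D ^ 2 := by
  have h := Literature.NumberTheory.Sieve.natCast_div_totient_le D
  rw [ell] at hℓ ⊢
  nlinarith

/-! ## 2. The `p`-independent coefficient: `(D/φ(D))·Σⱼ ℛ₁*ℛ₁ⱼ𝒮₁ⱼ → (𝔢₁ + 2𝔢₂ + 𝔢₃)𝔞` -/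

/-- **The coefficient of `p` in (15.17) tends to `(𝔢₁ + 2𝔢₂ + 𝔢₃)𝔞`** — the exact requirement of the
last step, ABSTRACT in the §15B objects `𝒮₁ⱼ, ℛ₁ⱼ, ℛ₁*`: it suffices that
`δ := Σⱼ|ℛ₁*ℛ₁ⱼ − (1,2,1)ⱼ|` satisfies `δ(1 + 𝔞) → 0` and that `(D/φ(D))·|𝒮₁ⱼ − 𝔢ⱼ𝔞φ(D)/D| → 0`;
then `(D/φ(D))Σ_{j≤3} ℛ₁*ℛ₁ⱼ𝒮₁ⱼ = (𝔢₁ + 2𝔢₂ + 𝔢₃)𝔞 + o(1)`. (Which printed rates give these two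
conditions is recorded in `eval1524_of_rates` / `eval1524_of_printedRates`.)
[cite: Zhang2022LandauSiegel, §15 (15.24) p.88] -/
theorem coeff_eventually {S R : ∀ (D : ℕ) [NeZero D], DirichletCharacter ℂ D → ℕ → ℂ}
    {Rs : ∀ (D : ℕ) [NeZero D], DirichletCharacter ℂ D → ℂ}
    (hη : ∀ ε : ℝ, 0 < ε → ForAllLarge fun D _ χ => AssumptionA D χ → ∀ j ∈ ({1, 2, 3} : Finset ℕ),
      (D : ℝ) / Nat.totient D * ‖S D χ j - frake j * (frakA χ : ℂ) * (Nat.totient D : ℂ) / (D : ℂ)‖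
        ≤ ε)
    (hδ : ∀ ε : ℝ, 0 < ε → ForAllLarge fun D _ χ => AssumptionA D χ →
      (‖Rs D χ * R D χ 1 - 1‖ + ‖Rs D χ * R D χ 2 - 2‖ + ‖Rs D χ * R D χ 3 - 1‖) *
        (1 + frakA χ) ≤ ε) :
    ∀ ε : ℝ, 0 < ε → ForAllLarge fun D _ χ => AssumptionA D χ →
      ‖((D : ℝ) / Nat.totient D : ℝ) * ∑ j ∈ ({1, 2, 3} : Finset ℕ), Rs D χ * R D χ j * S D χ j -
          (frake 1 + 2 * frake 2 + frake 3) * frakA χ‖ ≤ ε := by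
  intro ε hε
  set K : ℝ := ‖frake 1‖ + ‖frake 2‖ + ‖frake 3‖ with hK
  have hK0 : 0 ≤ K := by positivity
  set ε₁ : ℝ := min 1 (ε / (6 * (K + 1))) with hε₁
  have hε₁0 : 0 < ε₁ := lt_min one_pos (by positivity)
  have hε₁1 : ε₁ ≤ 1 := min_le_left _ _
  have hε₁K : ε₁ * (6 * (K + 1)) ≤ ε := by
    have := min_le_right 1 (ε / (6 * (K + 1)))
    rwa [← hε₁, le_div_iff₀ (by positivity)] at this
  obtain ⟨D₀, h⟩ := (hη (ε / 18) (by positivity)).and (hδ ε₁ hε₁0)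
  refine ⟨D₀, fun D _ χ hD hq hp hA => ?_⟩
  obtain ⟨h1, h2⟩ := h D χ hD hq hp
  have h1 := h1 hA
  have h2 := h2 hA
  have hD0 : 0 < D := Nat.pos_of_ne_zero (NeZero.ne D)
  have hφ0 : 0 < (Nat.totient D : ℝ) := by exact_mod_cast Nat.totient_pos.mpr hD0
  set t : ℝ := (D : ℝ) / Nat.totient D with ht
  have ht0 : 0 < t := div_pos (by exact_mod_cast hD0) hφ0
  have hA0 : 0 ≤ frakA χ := frakA_nonneg χ
  have hinv : ((Nat.totient D : ℂ)) / (D : ℂ) = ((t : ℝ) : ℂ)⁻¹ := by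
    rw [ht]; push_cast; rw [inv_div]
  -- split the sum over `{1, 2, 3}`
  have hsum : ((t : ℝ) : ℂ) * ∑ j ∈ ({1, 2, 3} : Finset ℕ), Rs D χ * R D χ j * S D χ j -
      (frake 1 + 2 * frake 2 + frake 3) * frakA χ =
      (((t : ℝ) : ℂ) * (Rs D χ * R D χ 1 * S D χ 1) - 1 * frake 1 * frakA χ) +
      (((t : ℝ) : ℂ) * (Rs D χ * R D χ 2 * S D χ 2) - 2 * frake 2 * frakA χ) +
      (((t : ℝ) : ℂ) * (Rs D χ * R D χ 3 * S D χ 3) - 1 * frake 3 * frakA χ) := by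
    rw [Finset.sum_insert (by simp), Finset.sum_insert (by simp), Finset.sum_singleton]
    ring
  rw [hsum]
  -- each piece: `‖δⱼ‖‖𝔢ⱼ‖𝔞 + t(‖mⱼ‖ + ‖δⱼ‖)‖ηⱼ‖ ≤ Kε₁ + 3·(ε/18)`
  set δs : ℝ := ‖Rs D χ * R D χ 1 - 1‖ + ‖Rs D χ * R D χ 2 - 2‖ + ‖Rs D χ * R D χ 3 - 1‖ with hδs
  have hδs0 : 0 ≤ δs := by positivity
  have hδs1 : δs ≤ ε₁ := by nlinarith
  have hδsA : δs * frakA χ ≤ ε₁ := by nlinarith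
  have piece : ∀ j ∈ ({1, 2, 3} : Finset ℕ), ∀ m : ℂ, ‖m‖ ≤ 2 → ‖Rs D χ * R D χ j - m‖ ≤ δs →
      ‖((t : ℝ) : ℂ) * (Rs D χ * R D χ j * S D χ j) - m * frake j * frakA χ‖ ≤
        K * ε₁ + 3 * (ε / 18) := by
    intro j hj m hm hu
    have hηj : t * ‖S D χ j - frake j * (frakA χ : ℂ) * ((t : ℝ) : ℂ)⁻¹‖ ≤ ε / 18 := by
      have := h1 j hj; rwa [mul_div_assoc, hinv] at this
    have hKj : ‖frake j‖ ≤ K := by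
      simp only [Finset.mem_insert, Finset.mem_singleton] at hj
      rcases hj with rfl | rfl | rfl <;> simp only [hK] <;> linarith [norm_nonneg (frake 1),
        norm_nonneg (frake 2), norm_nonneg (frake 3)]
    have huA : ‖Rs D χ * R D χ j - m‖ * frakA χ ≤ ε₁ :=
      (mul_le_mul_of_nonneg_right hu hA0).trans hδsA
    have hu1 : ‖Rs D χ * R D χ j - m‖ ≤ 1 := hu.trans (hδs1.trans hε₁1)
    calc ‖((t : ℝ) : ℂ) * (Rs D χ * R D χ j * S D χ j) - m * frake j * frakA χ‖
        ≤ ‖Rs D χ * R D χ j - m‖ * ‖frake j‖ * frakA χ +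
            t * (‖m‖ + ‖Rs D χ * R D χ j - m‖) *
              ‖S D χ j - frake j * frakA χ * ((t : ℝ) : ℂ)⁻¹‖ :=
          norm_comb_le ht0 hA0 (Rs D χ * R D χ j) (S D χ j) m (frake j)
      _ = ‖frake j‖ * (‖Rs D χ * R D χ j - m‖ * frakA χ) +
            (‖m‖ + ‖Rs D χ * R D χ j - m‖) *
              (t * ‖S D χ j - frake j * frakA χ * ((t : ℝ) : ℂ)⁻¹‖) := by ring
      _ ≤ K * ε₁ + (2 + 1) * (ε / 18) := by gcongr
      _ = K * ε₁ + 3 * (ε / 18) := by ring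
  have n1 := norm_nonneg (Rs D χ * R D χ 1 - 1)
  have n2 := norm_nonneg (Rs D χ * R D χ 2 - 2)
  have n3 := norm_nonneg (Rs D χ * R D χ 3 - 1)
  have hm1 : ‖(1 : ℂ)‖ ≤ 2 := by simp
  have hm2 : ‖(2 : ℂ)‖ ≤ 2 := by simp
  have hp1 := piece 1 (by simp) 1 hm1 (by rw [hδs]; linarith)
  have hp2 := piece 2 (by simp) 2 hm2 (by rw [hδs]; linarith)
  have hp3 := piece 3 (by simp) 1 hm1 (by rw [hδs]; linarith)
  calc ‖(((t : ℝ) : ℂ) * (Rs D χ * R D χ 1 * S D χ 1) - 1 * frake 1 * frakA χ) +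
        (((t : ℝ) : ℂ) * (Rs D χ * R D χ 2 * S D χ 2) - 2 * frake 2 * frakA χ) +
        (((t : ℝ) : ℂ) * (Rs D χ * R D χ 3 * S D χ 3) - 1 * frake 3 * frakA χ)‖
      ≤ ‖((t : ℝ) : ℂ) * (Rs D χ * R D χ 1 * S D χ 1) - 1 * frake 1 * frakA χ‖ +
        ‖((t : ℝ) : ℂ) * (Rs D χ * R D χ 2 * S D χ 2) - 2 * frake 2 * frakA χ‖ +
        ‖((t : ℝ) : ℂ) * (Rs D χ * R D χ 3 * S D χ 3) - 1 * frake 3 * frakA χ‖ :=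
          (norm_add_le _ _).trans (by gcongr; exact norm_add_le _ _)
    _ ≤ (K * ε₁ + 3 * (ε / 18)) + (K * ε₁ + 3 * (ε / 18)) + (K * ε₁ + 3 * (ε / 18)) :=
          add_le_add (add_le_add hp1 hp2) hp3
    _ = 3 * K * ε₁ + ε / 2 := by ring
    _ ≤ ε := by nlinarith

/-- The rate `O(𝓛⁻³)` of (15.23) as typed gives `(D/φ(D))·|𝒮₁ⱼ − 𝔢ⱼ𝔞φ(D)/D| → 0`
(`D/φ(D) ≤ (1 + log D)² ≤ 4𝓛²`). [cite: Zhang2022LandauSiegel, §15 (15.23) p.88] -/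
theorem eta_small_of_rate {S : ∀ (D : ℕ) [NeZero D], DirichletCharacter ℂ D → ℕ → ℂ}
    (h23 : ∃ C : ℝ, ForAllLarge fun D _ χ => AssumptionA D χ → ∀ j ∈ ({1, 2, 3} : Finset ℕ),
      ‖S D χ j - frake j * (frakA χ : ℂ) * (Nat.totient D : ℂ) / (D : ℂ)‖ ≤ C / ell D ^ 3) :
    ∀ ε : ℝ, 0 < ε → ForAllLarge fun D _ χ => AssumptionA D χ → ∀ j ∈ ({1, 2, 3} : Finset ℕ),
      (D : ℝ) / Nat.totient D * ‖S D χ j - frake j * (frakA χ : ℂ) * (Nat.totient D : ℂ) / (D : ℂ)‖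
        ≤ ε := by
  intro ε hε
  obtain ⟨C, hC⟩ := h23
  set M : ℝ := max 1 (4 * |C| / ε) with hM
  have hT : ForAllLarge fun D _ _ => M ≤ ell D :=
    ForAllLarge.of_le ⌈Real.exp M⌉₊ fun D _ _ hD _ _ => le_ell_of_ceil_exp_le hD
  obtain ⟨D₀, h⟩ := hC.and hT
  refine ⟨D₀, fun D _ χ hD hq hp hA j hj => ?_⟩
  obtain ⟨h1, h2⟩ := h D χ hD hq hp
  have hℓ1 : 1 ≤ ell D := (le_max_left _ _).trans h2
  have hℓ0 : 0 < ell D := by linarith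
  have hCε : 4 * |C| / ε ≤ ell D := (le_max_right _ _).trans h2
  have ht : (D : ℝ) / Nat.totient D ≤ 4 * ell D ^ 2 := totientRatio_le hℓ1
  have hη : ‖S D χ j - frake j * (frakA χ : ℂ) * (Nat.totient D : ℂ) / (D : ℂ)‖ ≤ |C| / ell D ^ 3 :=
    (h1 hA j hj).trans (by gcongr; exact le_abs_self C)
  have ht0 : 0 ≤ (D : ℝ) / Nat.totient D := by positivity
  calc (D : ℝ) / Nat.totient D * ‖S D χ j - frake j * (frakA χ : ℂ) * (Nat.totient D : ℂ) / (D : ℂ)‖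
      ≤ 4 * ell D ^ 2 * (|C| / ell D ^ 3) := mul_le_mul ht hη (norm_nonneg _) (by positivity)
    _ = 4 * |C| / ell D := by field_simp
    _ ≤ ε := by rw [div_le_iff₀ hℓ0]; rw [div_le_iff₀ hε] at hCε; linarith

/-- The FINER rate `ℛ₁*ℛ₁ⱼ = (1,2,1)ⱼ + O(𝓛⁻⁵)` gives `δ(1 + 𝔞) → 0` with the tree's crude
`𝔞 ≤ 16e⁹𝓛⁴` — no upper bound on `𝔞` beyond that is needed. [cite: Zhang2022LandauSiegel, §15 p.88] -/
theorem delta_small_of_rate5 {R : ∀ (D : ℕ) [NeZero D], DirichletCharacter ℂ D → ℕ → ℂ}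
    {Rs : ∀ (D : ℕ) [NeZero D], DirichletCharacter ℂ D → ℂ}
    (hprod : ∃ C : ℝ, ForAllLarge fun D _ χ => AssumptionA D χ →
      ‖Rs D χ * R D χ 1 - 1‖ ≤ C / ell D ^ 5 ∧ ‖Rs D χ * R D χ 2 - 2‖ ≤ C / ell D ^ 5 ∧
        ‖Rs D χ * R D χ 3 - 1‖ ≤ C / ell D ^ 5) :
    ∀ ε : ℝ, 0 < ε → ForAllLarge fun D _ χ => AssumptionA D χ →
      (‖Rs D χ * R D χ 1 - 1‖ + ‖Rs D χ * R D χ 2 - 2‖ + ‖Rs D χ * R D χ 3 - 1‖) *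
        (1 + frakA χ) ≤ ε := by
  intro ε hε
  obtain ⟨C, hC⟩ := hprod
  set M : ℝ := max 3 (3 * |C| * (1 + 16 * Real.exp 9) / ε) with hM
  have hT : ForAllLarge fun D _ _ => M ≤ ell D :=
    ForAllLarge.of_le ⌈Real.exp M⌉₊ fun D _ _ hD _ _ => le_ell_of_ceil_exp_le hD
  obtain ⟨D₀, h⟩ := hC.and hT
  refine ⟨D₀, fun D _ χ hD hq hp hA => ?_⟩
  obtain ⟨h1, h2⟩ := h D χ hD hq hp
  obtain ⟨hu1, hu2, hu3⟩ := h1 hA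
  have hℓ3 : 3 ≤ ell D := (le_max_left _ _).trans h2
  have hℓ0 : 0 < ell D := by linarith
  have hℓ1 : 1 ≤ ell D := by linarith
  have hCε : 3 * |C| * (1 + 16 * Real.exp 9) / ε ≤ ell D := (le_max_right _ _).trans h2
  have hA0 : 0 ≤ frakA χ := frakA_nonneg χ
  have hAle : frakA χ / ell D ^ 5 ≤ 16 * Real.exp 9 / ell D := frakA_div_le χ hℓ3 hp
  have hδ : ‖Rs D χ * R D χ 1 - 1‖ + ‖Rs D χ * R D χ 2 - 2‖ + ‖Rs D χ * R D χ 3 - 1‖ ≤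
      3 * |C| / ell D ^ 5 := by
    have e : ∀ x : ℝ, x ≤ C / ell D ^ 5 → x ≤ |C| / ell D ^ 5 := fun x hx =>
      hx.trans (by gcongr; exact le_abs_self C)
    have := e _ hu1; have := e _ hu2; have := e _ hu3
    have h3 : 3 * |C| / ell D ^ 5 = 3 * (|C| / ell D ^ 5) := by ring
    rw [h3]; linarith
  have h5 : 1 / ell D ^ 5 ≤ 1 / ell D := by
    gcongr; calc ell D = ell D ^ 1 := (pow_one _).symm
      _ ≤ ell D ^ 5 := pow_le_pow_right₀ hℓ1 (by norm_num)
  calc (‖Rs D χ * R D χ 1 - 1‖ + ‖Rs D χ * R D χ 2 - 2‖ + ‖Rs D χ * R D χ 3 - 1‖) * (1 + frakA χ)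
      ≤ 3 * |C| / ell D ^ 5 * (1 + frakA χ) := by gcongr
    _ = 3 * |C| * (1 / ell D ^ 5) + 3 * |C| * (frakA χ / ell D ^ 5) := by ring
    _ ≤ 3 * |C| * (1 / ell D) + 3 * |C| * (16 * Real.exp 9 / ell D) := by gcongr
    _ = 3 * |C| * (1 + 16 * Real.exp 9) / ell D := by ring
    _ ≤ ε := by rw [div_le_iff₀ hℓ0]; rw [div_le_iff₀ hε] at hCε; linarith

/-! ## 3. (15.6) + (15.17) + the coefficient limit ⇒ (15.24), abstract in the §15A/B objects -/

/-- **The last step of §15, kernel-checked** (§15 p.88, tex L4394–L4396: "Combining these relations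
with (15.23), (15.17) and (15.6) we conclude (15.24)"), ABSTRACT in the objects `Φ₁(p)`, `𝒮₁ⱼ`,
`ℛ₁ⱼ`, `ℛ₁*` of §15A/B: from (15.6) `Φ₁ = Σ_{p∼P}Φ₁(p) + o(𝔓)`, (15.17) `Φ₁(p) = ℛ₁*Dpφ(D)⁻¹Σ_{j≤3}
ℛ₁ⱼ𝒮₁ⱼ + o(p)` uniformly for `p ∼ P`, and the coefficient limit `(D/φ(D))Σⱼℛ₁*ℛ₁ⱼ𝒮₁ⱼ →
(𝔢₁ + 2𝔢₂ + 𝔢₃)𝔞` (`coeff_eventually`), conclude `Skeleton.Eval1524 c′`: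
`Φ₁ = (𝔢₁ + 2𝔢₂ + 𝔢₃)𝔞𝔓 + o(𝔓)` — the main term is linear in `p` and `Σ_{p∼P} p = 𝔓`.
[cite: Zhang2022LandauSiegel, §15 (15.24) p.88] -/
theorem eval1524_of_coeff {c' : ℝ}
    {Φp S R : ∀ (D : ℕ) [NeZero D], DirichletCharacter ℂ D → ℕ → ℂ}
    {Rs : ∀ (D : ℕ) [NeZero D], DirichletCharacter ℂ D → ℂ}
    (h6 : ∀ ε : ℝ, 0 < ε → ForAllLarge fun D _ χ => AssumptionA D χ →
      ‖Phi1 c' χ - ∑ p ∈ primeWindow D, Φp D χ p‖ ≤ ε * frakP D)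
    (h17 : ∀ ε : ℝ, 0 < ε → ForAllLarge fun D _ χ => AssumptionA D χ → ∀ p ∈ primeWindow D,
      ‖Φp D χ p - Rs D χ * (D : ℂ) * (p : ℂ) / (Nat.totient D : ℂ) *
          ∑ j ∈ ({1, 2, 3} : Finset ℕ), R D χ j * S D χ j‖ ≤ ε * p)
    (hcoeff : ∀ ε : ℝ, 0 < ε → ForAllLarge fun D _ χ => AssumptionA D χ →
      ‖((D : ℝ) / Nat.totient D : ℝ) * ∑ j ∈ ({1, 2, 3} : Finset ℕ), Rs D χ * R D χ j * S D χ j -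
          (frake 1 + 2 * frake 2 + frake 3) * frakA χ‖ ≤ ε) :
    Eval1524 c' := by
  intro ε hε
  have hε3 : 0 < ε / 3 := by positivity
  obtain ⟨D₀, h⟩ := ((h6 _ hε3).and (h17 _ hε3)).and (hcoeff _ hε3)
  refine ⟨D₀, fun D _ χ hD hq hp hA => ?_⟩
  obtain ⟨⟨e6, e17⟩, ec⟩ := h D χ hD hq hp
  have g6 := e6 hA
  have g17 := e17 hA
  have gc := ec hA
  set c : ℂ := frake 1 + 2 * frake 2 + frake 3 with hc
  set t : ℝ := (D : ℝ) / Nat.totient D with ht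
  set E : ℂ := ((t : ℝ) : ℂ) * ∑ j ∈ ({1, 2, 3} : Finset ℕ), Rs D χ * R D χ j * S D χ j -
    c * frakA χ with hE
  set mainp : ℕ → ℂ := fun p => Rs D χ * (D : ℂ) * (p : ℂ) / (Nat.totient D : ℂ) *
    ∑ j ∈ ({1, 2, 3} : Finset ℕ), R D χ j * S D χ j with hmainp
  have hD0 : 0 < D := Nat.pos_of_ne_zero (NeZero.ne D)
  have hφ : (Nat.totient D : ℂ) ≠ 0 := by exact_mod_cast (Nat.totient_pos.mpr hD0).ne'
  have hP0 : 0 ≤ frakP D := frakP_nonneg D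
  have key : ∀ p : ℕ, mainp p - (p : ℂ) * (c * frakA χ) = (p : ℂ) * E := by
    intro p
    have hs : ∑ j ∈ ({1, 2, 3} : Finset ℕ), Rs D χ * R D χ j * S D χ j =
        Rs D χ * ∑ j ∈ ({1, 2, 3} : Finset ℕ), R D χ j * S D χ j := by
      rw [Finset.mul_sum]; exact Finset.sum_congr rfl fun j _ => by ring
    simp only [hmainp, hE, hs, ht]
    push_cast
    field_simp
  have hPE : (frakP D : ℂ) * E = ∑ p ∈ primeWindow D, (p : ℂ) * E := by
    rw [frakP_eq_sum_primeWindow]; push_cast; rw [Finset.sum_mul]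
  have hcP : c * frakA χ * frakP D = ∑ p ∈ primeWindow D, (p : ℂ) * (c * frakA χ) := by
    rw [frakP_eq_sum_primeWindow]; push_cast; rw [Finset.mul_sum]
    exact Finset.sum_congr rfl fun p _ => by ring
  have decomp : Phi1 c' χ - c * frakA χ * frakP D =
      (Phi1 c' χ - ∑ p ∈ primeWindow D, Φp D χ p) +
        ∑ p ∈ primeWindow D, (Φp D χ p - mainp p) + (frakP D : ℂ) * E := by
    rw [hPE, hcP, Finset.sum_sub_distrib]
    have : ∑ p ∈ primeWindow D, (p : ℂ) * E =
        ∑ p ∈ primeWindow D, mainp p - ∑ p ∈ primeWindow D, (p : ℂ) * (c * frakA χ) := by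
      rw [← Finset.sum_sub_distrib]; exact Finset.sum_congr rfl fun p _ => (key p).symm
    rw [this]; ring
  rw [decomp]
  have hsum17 : ‖∑ p ∈ primeWindow D, (Φp D χ p - mainp p)‖ ≤ ε / 3 * frakP D := by
    refine (norm_sum_le _ _).trans ?_
    rw [frakP_eq_sum_primeWindow, Finset.mul_sum]
    exact Finset.sum_le_sum fun p hp' => g17 p hp'
  have hPEn : ‖(frakP D : ℂ) * E‖ ≤ ε / 3 * frakP D := by
    rw [norm_mul, Complex.norm_of_nonneg hP0, mul_comm]
    exact mul_le_mul_of_nonneg_right gc hP0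
  calc ‖(Phi1 c' χ - ∑ p ∈ primeWindow D, Φp D χ p) +
          ∑ p ∈ primeWindow D, (Φp D χ p - mainp p) + (frakP D : ℂ) * E‖
      ≤ ‖Phi1 c' χ - ∑ p ∈ primeWindow D, Φp D χ p‖ +
          ‖∑ p ∈ primeWindow D, (Φp D χ p - mainp p)‖ + ‖(frakP D : ℂ) * E‖ :=
        (norm_add_le _ _).trans (by gcongr; exact norm_add_le _ _)
    _ ≤ ε / 3 * frakP D + ε / 3 * frakP D + ε / 3 * frakP D := add_le_add (add_le_add g6 hsum17) hPEn
    _ = ε * frakP D := by ring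


/-- **(15.24) from (15.6), (15.17), (15.23) and the values `ℛ₁*ℛ₁ⱼ = 1, 2, 1 + O(𝓛⁻⁵)`** (the FINER
rate; what the tree's `𝔞 ≪ 𝓛⁴` absorbs) — unconditional in `𝔞`. [cite: Zhang2022LandauSiegel, §15 (15.24) p.88] -/
theorem eval1524_of_rates {c' : ℝ}
    {Φp S R : ∀ (D : ℕ) [NeZero D], DirichletCharacter ℂ D → ℕ → ℂ}
    {Rs : ∀ (D : ℕ) [NeZero D], DirichletCharacter ℂ D → ℂ}
    (h6 : ∀ ε : ℝ, 0 < ε → ForAllLarge fun D _ χ => AssumptionA D χ →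
      ‖Phi1 c' χ - ∑ p ∈ primeWindow D, Φp D χ p‖ ≤ ε * frakP D)
    (h17 : ∀ ε : ℝ, 0 < ε → ForAllLarge fun D _ χ => AssumptionA D χ → ∀ p ∈ primeWindow D,
      ‖Φp D χ p - Rs D χ * (D : ℂ) * (p : ℂ) / (Nat.totient D : ℂ) *
          ∑ j ∈ ({1, 2, 3} : Finset ℕ), R D χ j * S D χ j‖ ≤ ε * p)
    (h23 : ∃ C : ℝ, ForAllLarge fun D _ χ => AssumptionA D χ → ∀ j ∈ ({1, 2, 3} : Finset ℕ),
      ‖S D χ j - frake j * (frakA χ : ℂ) * (Nat.totient D : ℂ) / (D : ℂ)‖ ≤ C / ell D ^ 3)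
    (hprod : ∃ C : ℝ, ForAllLarge fun D _ χ => AssumptionA D χ →
      ‖Rs D χ * R D χ 1 - 1‖ ≤ C / ell D ^ 5 ∧ ‖Rs D χ * R D χ 2 - 2‖ ≤ C / ell D ^ 5 ∧
        ‖Rs D χ * R D χ 3 - 1‖ ≤ C / ell D ^ 5) :
    Eval1524 c' :=
  eval1524_of_coeff h6 h17 (coeff_eventually (eta_small_of_rate h23) (delta_small_of_rate5 hprod))

end Literature.NumberTheory.LFunctions.Zhang2022.Ded1524
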